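import Literature.RingTheory.SimpleModule.EndomorphismAlgebraFullOverCentralField
import Literature.LinearAlgebra.BaseChange.EndomorphismAlgebraImageBaseChange
import Mathlib.LinearAlgebra.Basis.VectorSpace
import HarnessLib

/-!
# A rank-one `Z`-projection inside a full algebra of `Z`-linear operators, and the invariance of its rank under base change

G. Shimura, *Abelian Varieties with Complex Multiplication and Modular Functions* (1998), §5.1 Proposition 1 (p. 36) and Propositions
3–4 (p. 37): in the extremal case `[𝔖 : ℚ] = 2 dim A` the commutant is split, `≅ M_d(Z)`, and a matrix unit `E₁₁` cuts out an abelian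
subvariety of dimension `[Z : ℚ]/2` on which `Z` acts with full degree; [Liu2021] App. D, proof of Thm. D.6 (1) (p. 140 l. 29–31): the block
`H¹_B(A_K, ℚ)[π^∞]` of the Jacobian and «`B₀` has complex multiplications».  Sequel, BY NAME, of ★ `EndomorphismAlgebraFullOverCentralField`
((a) `mem_of_forall_map_smul_of_finrank_eq`: a `k`-algebra `H` of `Z`-linear operators with `[Z:k]·dim_k H = (dim_k V)²` is ALL of `End_Z(V)`)
and of ★ `LinearAlgebra/BaseChange/{SubmoduleBaseChangeLattice, EndomorphismAlgebraImageBaseChange}` (`baseChange_range`, `finrank_baseChange_eq`).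

THIS FILE (theorems only; pure Mathlib + the two ★ files; any fields `k ⊆ Z`, `V` a finite-dimensional `Z`-space with `IsScalarTower k Z V`):
* `exists_isIdempotentElem_map_smul_finrank_range_eq` — if `V ≠ 0` there is an idempotent `k`-linear `e : V → V` which is `Z`-linear and whose
  image has `k`-dimension EXACTLY `[Z : k]` (the projection onto a `Z`-line along a `Z`-complement);
* **`exists_mem_isIdempotentElem_finrank_range_eq`** — under (a)'s hypothesis `[Z:k]·dim_k H = (dim_k V)²` such an `e` lies IN `H`
  (a RANK-ONE idempotent of the split algebra `H = End_Z(V) ≅ M_d(Z)`);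
* `finrank_range_baseChange_eq` — for any field extension `K/k`, `dim_K Im(e_(K)) = dim_k Im(e)` (right exactness + flatness), so the rank of
  `e` can be read after extension of scalars (e.g. on `ℚ̄_ℓ ⊗_ℚ V`).

DICTIONARY LINE (cell `hodgecm-mathlib`, crux `HLiu418` = stmt-HodgeConjecture-24832, d6 S2′ `BlockShape′`, the DEGREE conjunct
`Module.finrank ℚ R₀ = 2 * (image u₀).dim`; census `A-provers/A-p11/g12/CENSUS-S2prime-degree.A-p11g12.md` (D1)): `k = ℚ`, `Z = Zε` the block
field, `V = ε·H¹_B`, `H = εH_K` the block of the Hecke image; `e` is the rank-one corner with `dim_ℚ(e·V) = [Zε:ℚ]`, i.e. `2·dim(Im(d·e)) = [R₀:ℚ]`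
once the rank is transported to `ℚ̄_ℓ ⊗ H¹` (`finrank_range_baseChange_eq` + the Betti–étale comparison).  Count-neutral (HC_CM is proved only
modulo the 7 printed citations until rung 0 closes).

## References
* [Shimura1998] G. Shimura, *Abelian Varieties with Complex Multiplication and Modular Functions* (1998), §5.1 Proposition 1 (p. 36),
  Propositions 3–4 (p. 37).
* [Liu2021] Y. Liu, *Fourier–Jacobi cycles and arithmetic relative trace formula*, Camb. J. Math. 9 (2021), App. D, proof of Thm. D.6 (1)
  (p. 140).
* [BourbakiAlgebraI1989] N. Bourbaki, *Algebra I*, Ch. II §7 no. 7 Proposition 14 (extension of scalars and images).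
-/

namespace Literature.RingTheory.SimpleModule

open Module

universe u v w

section RankOne

variable (k : Type u) [Field k] (Z : Type v) [Field Z] [Algebra k Z] (V : Type w) [AddCommGroup V] [Module k V]
  [Module Z V] [IsScalarTower k Z V] [FiniteDimensional k Z] [FiniteDimensional Z V]

omit [FiniteDimensional k Z] [FiniteDimensional Z V] in
/-- **A rank-one `Z`-projection.**  If `V ≠ 0` there is an idempotent `k`-linear endomorphism `e` of `V` which is `Z`-linear and whose image
has `k`-dimension `[Z : k]`: the projection `x ↦ φ(x)·v` onto the line `Z·v` of a non-zero vector `v`, `φ` a `Z`-linear retraction of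
`z ↦ z·v`. [cite: Shimura1998, §5.1 Propositions 3–4 (p. 37)] -/
theorem exists_isIdempotentElem_map_smul_finrank_range_eq [Nontrivial V] :
    ∃ e : Module.End k V, IsIdempotentElem e ∧ (∀ (z : Z) (x : V), e (z • x) = z • e x) ∧
      finrank k (LinearMap.range e) = finrank k Z := by
  obtain ⟨v, hv⟩ := exists_ne (0 : V)
  -- the line `ι : Z → V`, `z ↦ z • v`, and a `Z`-linear retraction `φ`
  let ι : Z →ₗ[Z] V := LinearMap.toSpanSingleton Z V v
  have hιker : LinearMap.ker ι = ⊥ := LinearMap.ker_toSpanSingleton Z hv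
  obtain ⟨φ, hφ⟩ := ι.exists_leftInverse_of_injective hιker
  have hφι : ∀ z : Z, φ (ι z) = z := fun z => LinearMap.congr_fun hφ z
  have hφsurj : LinearMap.range φ = ⊤ := LinearMap.range_eq_top.2 fun z => ⟨ι z, hφι z⟩
  -- the projection `eZ = ι ∘ φ`
  let eZ : V →ₗ[Z] V := ι.comp φ
  have heZ : ∀ x, eZ (eZ x) = eZ x := fun x => by
    change ι (φ (ι (φ x))) = ι (φ x)
    rw [hφι]
  refine ⟨eZ.restrictScalars k, LinearMap.ext fun x => heZ x, fun z x => eZ.map_smul z x, ?_⟩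
  -- `Im e = Im ι ≅ Z`
  have hrange : LinearMap.range eZ = LinearMap.range ι := LinearMap.range_comp_of_range_eq_top _ hφsurj
  have hmem : ∀ x : V, x ∈ LinearMap.range (eZ.restrictScalars k) ↔ x ∈ LinearMap.range ι := fun x => by
    rw [LinearMap.range_restrictScalars, Submodule.restrictScalars_mem, hrange]
  let e₁ : (LinearMap.range (eZ.restrictScalars k)) ≃ₗ[k] (LinearMap.range ι) :=
    { toFun := fun x => ⟨x.1, (hmem x.1).1 x.2⟩
      invFun := fun y => ⟨y.1, (hmem y.1).2 y.2⟩
      map_add' := fun _ _ => rfl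
      map_smul' := fun _ _ => rfl
      left_inv := fun _ => rfl
      right_inv := fun _ => rfl }
  have e₂ : Z ≃ₗ[k] (LinearMap.range ι) :=
    (LinearEquiv.ofInjective ι (LinearMap.ker_eq_bot.1 hιker)).restrictScalars k
  rw [e₁.finrank_eq, ← e₂.finrank_eq]

variable {k Z V}

/-- **A rank-one idempotent INSIDE a full algebra of `Z`-linear operators.**  If `H ⊆ End_k(V)` consists of `Z`-linear operators and
`[Z : k] · dim_k H = (dim_k V)²` (so `H = End_Z(V) ≅ M_d(Z)` by ★ `mem_of_forall_map_smul_of_finrank_eq`), and `V ≠ 0`, then `H` contains an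
idempotent `e`, `Z`-linear, whose image has `k`-dimension exactly `[Z : k]` — the matrix unit `E₁₁` of Shimura's extremal case.
[cite: Shimura1998, §5.1 Proposition 1 (p. 36) and Propositions 3–4 (p. 37)] [cite: Liu2021, App. D, proof of Thm. D.6 (1) (p. 140)] -/
theorem exists_mem_isIdempotentElem_finrank_range_eq [Nontrivial V] (H : Subalgebra k (Module.End k V))
    (hHZ : ∀ h ∈ H, ∀ (z : Z) (x : V), h (z • x) = z • h x) (hdim : finrank k Z * finrank k H = finrank k V ^ 2) :
    ∃ e ∈ H, IsIdempotentElem e ∧ (∀ (z : Z) (x : V), e (z • x) = z • e x) ∧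
      finrank k (LinearMap.range e) = finrank k Z := by
  obtain ⟨e, he, heZ, hrank⟩ := exists_isIdempotentElem_map_smul_finrank_range_eq k Z V
  exact ⟨e, mem_of_forall_map_smul_of_finrank_eq H hHZ hdim e heZ, he, heZ, hrank⟩

end RankOne

section BaseChange

variable {k : Type*} [Field k] (K : Type*) [Field K] [Algebra k K] {V : Type*} [AddCommGroup V] [Module k V]

/-- **The rank of an endomorphism is unchanged by extension of scalars**: `dim_K Im(e_(K)) = dim_k Im(e)` (`Im(e_(K)) = Im(e)_(K)` by right
exactness, ★ `baseChange_range`, and `dim_K p_(K) = dim_k p` by flatness, ★ `finrank_baseChange_eq`).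
[cite: BourbakiAlgebraI1989, Ch. II §7 no. 7 Proposition 14] -/
theorem finrank_range_baseChange_eq (e : Module.End k V) :
    finrank K (LinearMap.range (e.baseChange K)) = finrank k (LinearMap.range e) := by
  rw [← Literature.LinearAlgebra.BaseChange.baseChange_range, Literature.LinearAlgebra.BaseChange.finrank_baseChange_eq]

end BaseChange

end Literature.RingTheory.SimpleModule
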